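import Literature.Analysis.FluidPDE.AxisymOmegaThetaEnergy
import Literature.Analysis.FluidPDE.AxisymSmallSwirlBootstrap
import Literature.Analysis.FluidPDE.ParticleTrajectoryFlowEstimates
import HarnessLib

/-!
# Lei–Zhang 2017, Thm. 1.4: the `L²` bound of `ω^θ` by Grönwall (Tao's class)

Analysis/FluidPDE proof file (theorems only; no definitions, no named facts) on the discharge path
of the named fact `Literature.Analysis.FluidPDE.LeiZhang2017_smallSwirl_regularity`
(Lei–Zhang 2017, Thm. 1.4).

After Lei–Zhang's a-priori bound `E(t) = ‖V²(t)‖² + ‖Ω(t)‖² ≤ E₀` and the dissipation bound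
`∫₀ᵀ ‖∇Ω‖² ≤ 2E₀` (`AxisymSmallSwirlBootstrap`), the `ω^θ`-energy inequality
`d/dt ‖ω^θ‖² ≤ 2‖vʳ/r‖_∞‖ω^θ‖² + ‖V²‖²` (`AxisymOmegaThetaEnergy`) and Lemma 2.1
(`‖vʳ/r‖_∞ ≤ C_A (‖Ω‖₂‖∂_zΩ‖₂)^{1/2}`) give, by Grönwall's inequality with the integrable kernel
`2‖vʳ/r‖_∞ ≤ 2C_A (E₀ ‖∇Ω‖²)^{1/4} ≤ 2C_A (1 + E₀‖∇Ω‖²)`, a bound of `‖ω^θ(t)‖_{L²}` on `[0, T]`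
depending only on `T`, `E₀`, `‖ω^θ₀‖_{L²}` and `C_A`.

* `IsTaoSolutionOn.omegaTheta_l2_balance`, `IsTaoSolutionOn.omegaTheta_sq_le` — under the hypotheses of
  `IsTaoSolutionOn.smallSwirl_energy_le`, for all `t ∈ [0, T]`,
  `∫ r²Ω(t)² ≤ (∫ r²Ω₀² + E₀ T) · exp (2 C_A (T + 4 E₀²))`.

## Mathlib / tree search

Tree: `IsTaoSolutionOn.omegaTheta_slice_le` (`AxisymOmegaThetaEnergy`),
`IsTaoSolutionOn.energy_balance / smallSwirl_energy_le` (`AxisymSmallSwirlBootstrap`),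
`IsAxisymmetric.abs_radVelQuot_le_of_sobolev` (`HouLiVariablesMemLp`),
`IsSmoothSpaceTimeOn.l2_balance` (`ClassicalL2Stability`), `real_gronwall_Icc`
(`ParticleTrajectoryFlowEstimates`, measurability-free Grönwall with lower integrals).

## References

* Z. Lei, Q. S. Zhang, Pacific J. Math. 289 (2017) 169–187, arXiv:1505.02628, §4 (p. 10).
  [`LeiZhang2017`]
* A. J. Majda, A. L. Bertozzi, Vorticity and incompressible flow, CUP 2002, Lemma 4.7. [folklore]
-/

noncomputable section

open MeasureTheory Set Function Filter Topology InnerProductSpace WithLp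
open scoped RealInnerProductSpace Laplacian ContDiff ENNReal NNReal

namespace Literature.Analysis.FluidPDE

/-! ### Small real-analysis helpers -/

section Helpers

/-- `√√z ≤ 1 + z` for `z ≥ 0`. [folklore] -/
theorem sqrt_sqrt_le_one_add {z : ℝ} (hz : 0 ≤ z) : Real.sqrt (Real.sqrt z) ≤ 1 + z := by
  set s := Real.sqrt (Real.sqrt z) with hs
  have hs0 : 0 ≤ s := Real.sqrt_nonneg _
  have hs2 : s ^ 2 = Real.sqrt z := Real.sq_sqrt (Real.sqrt_nonneg _)
  have hs4 : s ^ 4 = z := by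
    rw [show (4 : ℕ) = 2 * 2 from rfl, pow_mul, hs2, Real.sq_sqrt hz]
  rcases le_total s 1 with h | h
  · linarith
  · have : s ≤ s ^ 4 := by nlinarith [pow_le_pow_left₀ zero_le_one h 3]
    linarith

/-- `∫ f ≤ (∫⁻ ofReal g).toReal` for an integrable `f ≤ g` a.e., `g ≥ 0` a.e., with
`∫⁻ ofReal g < ∞` (no measurability of `g` needed). [folklore] -/
theorem integral_le_toReal_lintegral_of_le {α : Type*} [MeasurableSpace α] {μ : Measure α}
    {f g : α → ℝ} (hf : Integrable f μ) (hg : ∀ᵐ a ∂μ, 0 ≤ g a) (hfg : ∀ᵐ a ∂μ, f a ≤ g a)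
    (hfin : ∫⁻ a, ENNReal.ofReal (g a) ∂μ ≠ ⊤) :
    ∫ a, f a ∂μ ≤ (∫⁻ a, ENNReal.ofReal (g a) ∂μ).toReal := by
  calc ∫ a, f a ∂μ ≤ ∫ a, max (f a) 0 ∂μ := integral_mono hf hf.pos_part fun a => le_max_left _ _
    _ = (∫⁻ a, ENNReal.ofReal (max (f a) 0) ∂μ).toReal :=
        integral_eq_lintegral_of_nonneg_ae (Eventually.of_forall fun a => le_max_right _ _)
          hf.pos_part.aestronglyMeasurable
    _ ≤ (∫⁻ a, ENNReal.ofReal (g a) ∂μ).toReal := by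
        refine ENNReal.toReal_mono hfin (lintegral_mono_ae ?_)
        filter_upwards [hg, hfg] with a ha hfa
        exact ENNReal.ofReal_le_ofReal (max_le hfa ha)

end Helpers

/-! ### The `ω^θ` bound -/

namespace IsTaoSolutionOn

variable {T : ℝ} {u₀ : EuclideanSpace ℝ (Fin 3) → EuclideanSpace ℝ (Fin 3)}
  {u : ℝ → EuclideanSpace ℝ (Fin 3) → EuclideanSpace ℝ (Fin 3)} {p : ℝ → EuclideanSpace ℝ (Fin 3) → ℝ}

/-- **The `ω^θ` balance in Tao's class**: `Y(t) = ∫ r²Ω(t)² (= ‖ω^θ(t)‖²)` is continuous on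
`[0, T]`, its density `2∫ r²ΩΩ'` is integrable on `(0, T)`, and `Y(b) = Y(0) + ∫₀ᵇ 2∫ r²ΩΩ'`
(`IsSmoothSpaceTimeOn.l2_balance` for the carrier `Ω • J x`). [folklore] -/
theorem omegaTheta_l2_balance {ν : ℝ} (h : IsTaoSolutionOn T ν u₀ u p) (hT : 0 < T)
    (hax : ∀ t ∈ Icc 0 T, IsAxisymmetric (u t)) :
    ContinuousOn (fun t => ∫ x : EuclideanSpace ℝ (Fin 3), (x 0 ^ 2 + x 1 ^ 2) * angVortQuot (u t) x ^ 2) (Icc 0 T) ∧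
    IntegrableOn (fun t => 2 * ∫ x : EuclideanSpace ℝ (Fin 3), (x 0 ^ 2 + x 1 ^ 2) * angVortQuot (u t) x *
      angVortQuot (FluidPDE.timeDerivWithin (Icc 0 T) u t) x) (Ioo 0 T) volume ∧
    ∀ b ∈ Ioc 0 T, ∫ x : EuclideanSpace ℝ (Fin 3), (x 0 ^ 2 + x 1 ^ 2) * angVortQuot (u b) x ^ 2 =
      (∫ x : EuclideanSpace ℝ (Fin 3), (x 0 ^ 2 + x 1 ^ 2) * angVortQuot (u 0) x ^ 2) +
      ∫ t in (0 : ℝ)..b, 2 * ∫ x : EuclideanSpace ℝ (Fin 3), (x 0 ^ 2 + x 1 ^ 2) * angVortQuot (u t) x *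
        angVortQuot (FluidPDE.timeDerivWithin (Icc 0 T) u t) x := by
  have hcl := h.classical
  have hsm : IsSmoothSpaceTimeOn (Icc 0 T) u := hcl.smooth_velocity
  have hU : UniqueDiffOn ℝ (Icc 0 T) := uniqueDiffOn_Icc hT
  have hcvx : Convex ℝ (Icc 0 T) := convex_Icc 0 T
  have hIcl : Icc 0 T ⊆ closure (interior (Icc 0 T)) := by rw [interior_Icc, closure_Ioo hT.ne]
  set Ωf : ℝ → EuclideanSpace ℝ (Fin 3) → ℝ := fun t => angVortQuot (u t) with hΩf
  set Ω'f : ℝ → EuclideanSpace ℝ (Fin 3) → ℝ := fun t => angVortQuot (FluidPDE.timeDerivWithin (Icc 0 T) u t)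
    with hΩ'f
  have hΩs : IsSmoothSpaceTimeOn (Icc 0 T) Ωf := hsm.angVortQuot_family hcvx hU
  have hΩ' : ∀ t ∈ Icc 0 T, ∀ x, FluidPDE.timeDerivWithin (Icc 0 T) Ωf t x = Ω'f t x := fun t ht x =>
    hsm.timeDerivWithin_angVortQuot hcvx hU hIcl hax ht x
  -- the carrier `Ω • J x`
  set w : ℝ → EuclideanSpace ℝ (Fin 3) → EuclideanSpace ℝ (Fin 3) := fun t x => Ωf t x • rotGenL x with hw
  have hws : IsSmoothSpaceTimeOn (Icc 0 T) w :=
    hΩs.smul (isSmoothSpaceTimeOn_const_time rotGenL.contDiff _)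
  have hw' : ∀ t ∈ Icc 0 T, ∀ x, FluidPDE.timeDerivWithin (Icc 0 T) w t x = Ω'f t x • rotGenL x := by
    intro t ht x
    have hΩd : HasDerivWithinAt (fun s => Ωf s x) (Ω'f t x) (Icc 0 T) t := by
      have := hΩs.hasDerivWithinAt_timeDerivWithin hU ht x
      rwa [hΩ' t ht x] at this
    simp only [timeDerivWithin_apply]
    exact (hΩd.smul_const (rotGenL x)).derivWithin (hU t ht)
  have hρJ : ∀ x : EuclideanSpace ℝ (Fin 3), ‖rotGenL x‖ ^ 2 = x 0 ^ 2 + x 1 ^ 2 := fun x => by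
    rw [rotGenL_apply]; exact norm_rotGen_sq x
  have hnw : ∀ t x, ‖w t x‖ ^ 2 = (x 0 ^ 2 + x 1 ^ 2) * Ωf t x ^ 2 := fun t x => by
    simp only [hw]; rw [norm_smul, mul_pow, hρJ, Real.norm_eq_abs, sq_abs]; ring
  have hnw' : ∀ t ∈ Icc 0 T, ∀ x, ‖FluidPDE.timeDerivWithin (Icc 0 T) w t x‖ ^ 2 =
      (x 0 ^ 2 + x 1 ^ 2) * Ω'f t x ^ 2 := fun t ht x => by
    rw [hw' t ht x, norm_smul, mul_pow, hρJ, Real.norm_eq_abs, sq_abs]; ring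
  have hinner : ∀ t ∈ Icc 0 T, ∀ x, 2 * ⟪w t x, FluidPDE.timeDerivWithin (Icc 0 T) w t x⟫ =
      2 * ((x 0 ^ 2 + x 1 ^ 2) * Ωf t x * Ω'f t x) := fun t ht x => by
    rw [hw' t ht x]
    simp only [hw]
    rw [real_inner_smul_left, real_inner_smul_right, real_inner_self_eq_norm_sq, hρJ]; ring
  -- uniform `L²` bounds from `r|Ω| ≤ |curl u|`
  have hsmooth : ∀ t ∈ Icc 0 T, ContDiff ℝ ∞ (u t) := fun t ht => hcl.contDiff_velocity ht
  have hsmooth' : ∀ t ∈ Icc 0 T, ContDiff ℝ ∞ (FluidPDE.timeDerivWithin (Icc 0 T) u t) := fun t ht =>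
    hsm.contDiff_timeDerivWithin_slice hU ht
  have hax' : ∀ t ∈ Icc 0 T, IsAxisymmetric (FluidPDE.timeDerivWithin (Icc 0 T) u t) := fun t ht =>
    hsm.isAxisymmetric_timeDerivWithin hax ht
  set c : ℝ := ‖(curlCLM : (EuclideanSpace ℝ (Fin 3) →L[ℝ] EuclideanSpace ℝ (Fin 3)) →L[ℝ]
      EuclideanSpace ℝ (Fin 3))‖ with hc_def
  have hc0 : 0 ≤ c := by positivity
  have hptbound : ∀ {v : EuclideanSpace ℝ (Fin 3) → EuclideanSpace ℝ (Fin 3)}, ContDiff ℝ ∞ v → IsAxisymmetric v →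
      ∀ x : EuclideanSpace ℝ (Fin 3), ENNReal.ofReal ((x 0 ^ 2 + x 1 ^ 2) * angVortQuot v x ^ 2) ≤
        ENNReal.ofReal (c ^ 2) * ‖iteratedFDeriv ℝ 1 v x‖ₑ ^ 2 := by
    intro v hv hva x
    have h1 := hva.cylRadius_mul_abs_angVortQuot_le (hv.of_le (by norm_cast)) x
    have h2 := norm_iteratedFDeriv_curl_le (n := 0) (by exact_mod_cast hv.of_le (by norm_cast)) x
    rw [norm_iteratedFDeriv_zero] at h2
    have h3 : (x 0 ^ 2 + x 1 ^ 2) * angVortQuot v x ^ 2 ≤ c ^ 2 * ‖iteratedFDeriv ℝ 1 v x‖ ^ 2 := by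
      rw [← cylRadius_sq, ← mul_pow, ← sq_abs (cylRadius x * _), abs_mul, abs_of_nonneg (cylRadius_nonneg x),
        ← mul_pow]
      exact pow_le_pow_left₀ (mul_nonneg (cylRadius_nonneg x) (abs_nonneg _)) (h1.trans h2) 2
    calc ENNReal.ofReal ((x 0 ^ 2 + x 1 ^ 2) * angVortQuot v x ^ 2)
        ≤ ENNReal.ofReal (c ^ 2 * ‖iteratedFDeriv ℝ 1 v x‖ ^ 2) := ENNReal.ofReal_le_ofReal h3
      _ = ENNReal.ofReal (c ^ 2) * ‖iteratedFDeriv ℝ 1 v x‖ₑ ^ 2 := by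
          rw [ENNReal.ofReal_mul (sq_nonneg _), ← ofReal_norm, ENNReal.ofReal_pow (norm_nonneg _)]
  obtain ⟨C₁, hC₁⟩ := h.sobolev 1
  obtain ⟨C₁', hC₁'⟩ := h.sobolev_dt 1
  have hC₀ : ∀ t ∈ Icc 0 T, ∫⁻ x, ‖w t x‖ₑ ^ 2 ≤ Real.toNNReal (c ^ 2) * C₁ := by
    intro t ht
    calc ∫⁻ x, ‖w t x‖ₑ ^ 2 = ∫⁻ x, ENNReal.ofReal ((x 0 ^ 2 + x 1 ^ 2) * Ωf t x ^ 2) :=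
          lintegral_congr fun x => by rw [← ofReal_norm, ← ENNReal.ofReal_pow (norm_nonneg _), hnw]
      _ ≤ ∫⁻ x, ENNReal.ofReal (c ^ 2) * ‖iteratedFDeriv ℝ 1 (u t) x‖ₑ ^ 2 :=
          lintegral_mono fun x => hptbound (hsmooth t ht) (hax t ht) x
      _ = ENNReal.ofReal (c ^ 2) * ∫⁻ x, ‖iteratedFDeriv ℝ 1 (u t) x‖ₑ ^ 2 :=
          lintegral_const_mul' _ _ ENNReal.ofReal_ne_top
      _ ≤ ENNReal.ofReal (c ^ 2) * C₁ := by gcongr; exact hC₁ t ht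
      _ = _ := rfl
  have hC₁b : ∀ t ∈ Icc 0 T, ∫⁻ x, ‖FluidPDE.timeDerivWithin (Icc 0 T) w t x‖ₑ ^ 2 ≤ Real.toNNReal (c ^ 2) * C₁' := by
    intro t ht
    calc ∫⁻ x, ‖FluidPDE.timeDerivWithin (Icc 0 T) w t x‖ₑ ^ 2
        = ∫⁻ x, ENNReal.ofReal ((x 0 ^ 2 + x 1 ^ 2) * Ω'f t x ^ 2) :=
          lintegral_congr fun x => by rw [← ofReal_norm, ← ENNReal.ofReal_pow (norm_nonneg _), hnw' t ht]
      _ ≤ ∫⁻ x, ENNReal.ofReal (c ^ 2) * ‖iteratedFDeriv ℝ 1 (FluidPDE.timeDerivWithin (Icc 0 T) u t) x‖ₑ ^ 2 :=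
          lintegral_mono fun x => hptbound (hsmooth' t ht) (hax' t ht) x
      _ = ENNReal.ofReal (c ^ 2) * ∫⁻ x, ‖iteratedFDeriv ℝ 1 (FluidPDE.timeDerivWithin (Icc 0 T) u t) x‖ₑ ^ 2 :=
          lintegral_const_mul' _ _ ENNReal.ofReal_ne_top
      _ ≤ ENNReal.ofReal (c ^ 2) * C₁' := by gcongr; exact hC₁' t ht
      _ = _ := rfl
  obtain ⟨hint, hcont, hbal⟩ := hws.l2_balance hT hC₀ hC₁b
  have hE : ∀ t, (∫ x, ‖w t x‖ ^ 2) = ∫ x : EuclideanSpace ℝ (Fin 3), (x 0 ^ 2 + x 1 ^ 2) * Ωf t x ^ 2 := fun t =>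
    integral_congr_ae (ae_of_all _ fun x => hnw t x)
  have hden : ∀ t ∈ Icc 0 T, ∫ x, 2 * ⟪w t x, FluidPDE.timeDerivWithin (Icc 0 T) w t x⟫ =
      2 * ∫ x : EuclideanSpace ℝ (Fin 3), (x 0 ^ 2 + x 1 ^ 2) * Ωf t x * Ω'f t x := fun t ht => by
    rw [integral_congr_ae (ae_of_all _ (hinner t ht)), integral_const_mul]
  refine ⟨hcont.congr fun t _ => (hE t).symm, ?_, fun b hb => ?_⟩
  · exact hint.congr_fun (fun t ht => hden t (Ioo_subset_Icc_self ht)) measurableSet_Ioo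
  · have hb' := hbal b hb
    rw [hE, hE] at hb'
    rw [hb']
    congr 1
    refine intervalIntegral.integral_congr fun t ht => ?_
    rw [uIcc_of_le hb.1.le] at ht
    exact hden t ⟨ht.1, ht.2.trans hb.2⟩

/-- **Lei–Zhang 2017, Thm. 1.4: the `L²` bound of `ω^θ`.** Under the hypotheses of
`IsTaoSolutionOn.smallSwirl_energy_le` (Tao's class, `ν = 1`, axisymmetric slices, `|Γ₀| ≤ M`,
`Γ₀ ∈ L²`, `E₀ < L`, `C_A (L M² ‖Γ₀‖²)^{1/4} ≤ 1/3`), for all `t ∈ [0, T]`,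
`∫ r²Ω(t)² ≤ (∫ r²Ω₀² + E₀ T) · exp (2 C_A (T + 2 E₀²))` where `E₀ = ∫ (r²Φ₀⁴ + Ω₀²)`
(`r²Ω² = (ω^θ)²`): Grönwall for `d/dt‖ω^θ‖² ≤ 2‖vʳ/r‖_∞‖ω^θ‖² + ‖V²‖²` with
`2‖vʳ/r‖_∞ ≤ 2C_A(E₀‖∇Ω‖²)^{1/4} ≤ 2C_A(1 + E₀‖∇Ω‖²)` and `∫₀ᵀ‖∇Ω‖² ≤ 2E₀`.
[cite: LeiZhang2017, §4 (p. 10)] -/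
theorem omegaTheta_sq_le (h : IsTaoSolutionOn T 1 u₀ u p) (hT : 0 < T)
    (hax : ∀ t ∈ Icc 0 T, IsAxisymmetric (u t)) {M : ℝ} (hM : ∀ x, |swirl u₀ x| ≤ M)
    (hΓ0 : ∫⁻ x, ‖swirl u₀ x‖ₑ ^ 2 < ⊤) {L : ℝ}
    (hL : (∫ x : EuclideanSpace ℝ (Fin 3), ((x 0 ^ 2 + x 1 ^ 2) * angVelQuot u₀ x ^ 4 + angVortQuot u₀ x ^ 2)) < L)
    (hsmall : (Real.sqrt newtonNearSqInt + newtonFarLaplacianL65 *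
        SNormLESNormFDerivOfEqConst ℝ (volume : Measure (EuclideanSpace ℝ (Fin 3))) 2) *
      Real.sqrt (Real.sqrt (L * (M ^ 2 * ∫ x, swirl u₀ x ^ 2))) ≤ 1 / 3) :
    ∀ t ∈ Icc 0 T, ∫ x : EuclideanSpace ℝ (Fin 3), (x 0 ^ 2 + x 1 ^ 2) * angVortQuot (u t) x ^ 2 ≤
      ((∫ x : EuclideanSpace ℝ (Fin 3), (x 0 ^ 2 + x 1 ^ 2) * angVortQuot u₀ x ^ 2) +
        (∫ x : EuclideanSpace ℝ (Fin 3), ((x 0 ^ 2 + x 1 ^ 2) * angVelQuot u₀ x ^ 4 + angVortQuot u₀ x ^ 2)) * T) *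
      Real.exp (2 * (Real.sqrt newtonNearSqInt + newtonFarLaplacianL65 *
        SNormLESNormFDerivOfEqConst ℝ (volume : Measure (EuclideanSpace ℝ (Fin 3))) 2) *
        (T + 2 * (∫ x : EuclideanSpace ℝ (Fin 3), ((x 0 ^ 2 + x 1 ^ 2) * angVelQuot u₀ x ^ 4 + angVortQuot u₀ x ^ 2)) ^ 2)) := by
  set CA : ℝ := Real.sqrt newtonNearSqInt + newtonFarLaplacianL65 *
    SNormLESNormFDerivOfEqConst ℝ (volume : Measure (EuclideanSpace ℝ (Fin 3))) 2 with hCA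
  have hCA0 : 0 ≤ CA := by
    have := newtonFarLaplacianL65_nonneg; positivity
  -- the energy `E`, its density and the `ω^θ`-energy `Y`
  obtain ⟨-, hintD, hbalE⟩ := h.energy_balance hT hax
  obtain ⟨hEle, hdens⟩ := h.smallSwirl_energy_le hT hax hM hΓ0 hL hsmall
  obtain ⟨hcontY, hintY, hbalY⟩ := h.omegaTheta_l2_balance hT hax
  set E : ℝ → ℝ := fun t => ∫ x : EuclideanSpace ℝ (Fin 3),
    ((x 0 ^ 2 + x 1 ^ 2) * angVelQuot (u t) x ^ 4 + angVortQuot (u t) x ^ 2) with hE_def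
  set dens : ℝ → ℝ := fun t => 4 * (∫ x : EuclideanSpace ℝ (Fin 3), (x 0 ^ 2 + x 1 ^ 2) * angVelQuot (u t) x ^ 3 *
      angVelQuot (FluidPDE.timeDerivWithin (Icc 0 T) u t) x) +
    2 * ∫ x, angVortQuot (u t) x * angVortQuot (FluidPDE.timeDerivWithin (Icc 0 T) u t) x with hdens_def
  set Y : ℝ → ℝ := fun t => ∫ x : EuclideanSpace ℝ (Fin 3), (x 0 ^ 2 + x 1 ^ 2) * angVortQuot (u t) x ^ 2 with hY_def
  set dY : ℝ → ℝ := fun t => 2 * ∫ x : EuclideanSpace ℝ (Fin 3), (x 0 ^ 2 + x 1 ^ 2) * angVortQuot (u t) x *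
      angVortQuot (FluidPDE.timeDerivWithin (Icc 0 T) u t) x with hdY_def
  have hE0 : E 0 = ∫ x : EuclideanSpace ℝ (Fin 3), ((x 0 ^ 2 + x 1 ^ 2) * angVelQuot u₀ x ^ 4 + angVortQuot u₀ x ^ 2) := by
    simp only [hE_def, h.initial]
  have hY0 : Y 0 = ∫ x : EuclideanSpace ℝ (Fin 3), (x 0 ^ 2 + x 1 ^ 2) * angVortQuot u₀ x ^ 2 := by
    simp only [hY_def, h.initial]
  rw [← hE0, ← hY0]
  set E₀ : ℝ := E 0 with hE₀
  -- basic signs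
  have hρ0 : ∀ x : EuclideanSpace ℝ (Fin 3), 0 ≤ x 0 ^ 2 + x 1 ^ 2 := fun x => by positivity
  have hEnn : ∀ t, 0 ≤ E t := fun t => integral_nonneg fun x => by
    have := hρ0 x; positivity
  have hYnn : ∀ t, 0 ≤ Y t := fun t => integral_nonneg fun x => mul_nonneg (hρ0 x) (sq_nonneg _)
  have hE00 : 0 ≤ E₀ := hEnn 0
  have hEt : ∀ t ∈ Icc 0 T, E t ≤ E₀ := fun t ht => by
    have := hEle t ht
    rw [← hE0] at this
    exact this
  -- the dissipation `X`
  set X : ℝ → ℝ := fun t => ∫ x, (fderiv ℝ (angVortQuot (u t)) x (EuclideanSpace.single 0 1) ^ 2 +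
      fderiv ℝ (angVortQuot (u t)) x (EuclideanSpace.single 1 1) ^ 2 +
      fderiv ℝ (angVortQuot (u t)) x (EuclideanSpace.single 2 1) ^ 2) with hX_def
  have hX0 : ∀ t, 0 ≤ X t := fun t => integral_nonneg fun x => by positivity
  have hdX : ∀ t ∈ Icc 0 T, X t ≤ -2 * dens t := fun t ht => by
    have := hdens t ht; simp only [hdens_def, hX_def] at this ⊢; linarith
  have hdens0 : ∀ t ∈ Icc 0 T, dens t ≤ 0 := fun t ht => by have := hdX t ht; have := hX0 t; linarith
  -- the kernel
  set κ : ℝ → ℝ := fun t => 2 * CA * Real.sqrt (Real.sqrt (E₀ * (-2 * dens t))) with hκ_def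
  have hκ0 : ∀ t, 0 ≤ κ t := fun t => mul_nonneg (mul_nonneg zero_le_two hCA0) (Real.sqrt_nonneg _)
  have hκle : ∀ t ∈ Icc 0 T, κ t ≤ 2 * CA * (1 + E₀ * (-2 * dens t)) := fun t ht =>
    mul_le_mul_of_nonneg_left (sqrt_sqrt_le_one_add (mul_nonneg hE00 (by have := hdens0 t ht; linarith)))
      (mul_nonneg zero_le_two hCA0)
  ------------------------------------------------------------------
  -- Step 1: the slice inequality `dY ≤ κ Y + E₀`
  ------------------------------------------------------------------
  have hcl := h.classical
  have hslice : ∀ t ∈ Icc 0 T, dY t ≤ κ t * Y t + E₀ := by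
    intro t ht
    have hut : ContDiff ℝ ∞ (u t) := hcl.contDiff_velocity ht
    have hH : ∀ n : ℕ, ∫⁻ x, ‖iteratedFDeriv ℝ n (u t) x‖ₑ ^ 2 < ⊤ := fun n => by
      obtain ⟨C, hC⟩ := h.sobolev n; exact (hC t ht).trans_lt ENNReal.coe_lt_top
    -- the sup bound of `vʳ/r`
    set Bq : ℝ := ∫ x, angVortQuot (u t) x ^ 2 with hBq
    set a : ℝ := ∫ x, fderiv ℝ (angVortQuot (u t)) x (EuclideanSpace.single 2 1) ^ 2 with ha
    have hBq0 : 0 ≤ Bq := integral_nonneg fun x => sq_nonneg _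
    have ha0 : 0 ≤ a := integral_nonneg fun x => sq_nonneg _
    have hW : ∀ x, |radVelQuot (u t) x| ≤ CA * Real.sqrt (Real.sqrt (Bq * a)) := by
      intro x
      have hh := (hax t ht).abs_radVelQuot_le_of_sobolev hut (hcl.divFree t ht) hH x
      have hq : ∀ {y : ℝ}, 0 ≤ y → Real.sqrt (Real.sqrt y) = y ^ (1 / 4 : ℝ) := fun hy => by
        rw [Real.sqrt_eq_rpow, Real.sqrt_eq_rpow, ← Real.rpow_mul hy]; norm_num
      rwa [← hq (mul_nonneg hBq0 ha0)] at hh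
    have hsl := h.omegaTheta_slice_le hT hax ht hW
    -- `A ≤ E ≤ E₀`, `Bq ≤ E ≤ E₀`, `a ≤ X ≤ −2 dens`
    have hus : ContDiff ℝ ∞ (u t) := hut
    have mΩ : MemLp (angVortQuot (u t)) 2 volume := memLp_of_sobolev (contDiff_angVortQuot_of_contDiff hus)
      ((hax t ht).lintegral_sq_iteratedFDeriv_angVortQuot_lt_top hus hH)
    have mΦ : MemLp (angVelQuot (u t)) 2 volume := memLp_of_sobolev (contDiff_angVelQuot_of_contDiff hus)
      ((hax t ht).lintegral_sq_iteratedFDeriv_angVelQuot_lt_top hus hH)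
    obtain ⟨B, -, hB⟩ := h.exists_bound_velocity
    have hB₂ : ∀ x : EuclideanSpace ℝ (Fin 3), (x 0 ^ 2 + x 1 ^ 2) * angVelQuot (u t) x ^ 2 ≤ B ^ 2 := fun x =>
      ((hax t ht).horizSq_mul_angVelQuot_sq_le (hus.of_le (by norm_cast)) x).trans
        (pow_le_pow_left₀ (norm_nonneg _) (hB t ht x) 2)
    have cP : Continuous fun x : EuclideanSpace ℝ (Fin 3) => (x 0 ^ 2 + x 1 ^ 2) * angVelQuot (u t) x ^ 2 :=
      (contDiff_horizSq (n := 0)).continuous.mul ((contDiff_angVelQuot_of_contDiff hus).continuous.pow 2)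
    have iA : Integrable (fun x : EuclideanSpace ℝ (Fin 3) => (x 0 ^ 2 + x 1 ^ 2) * angVelQuot (u t) x ^ 4) volume :=
      (mΦ.integrable_sq.bdd_mul cP.aestronglyMeasurable (ae_of_all _ fun x => by
        rw [Real.norm_of_nonneg (mul_nonneg (hρ0 x) (sq_nonneg _))]; exact hB₂ x)).congr
        (ae_of_all _ fun x => by simp only; ring)
    have hEsplit : E t = (∫ x : EuclideanSpace ℝ (Fin 3), (x 0 ^ 2 + x 1 ^ 2) * angVelQuot (u t) x ^ 4) + Bq := by
      simp only [hE_def, hBq]; exact integral_add iA mΩ.integrable_sq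
    have hA0 : 0 ≤ ∫ x : EuclideanSpace ℝ (Fin 3), (x 0 ^ 2 + x 1 ^ 2) * angVelQuot (u t) x ^ 4 :=
      integral_nonneg fun x => mul_nonneg (hρ0 x) (by positivity)
    have hAle : ∫ x : EuclideanSpace ℝ (Fin 3), (x 0 ^ 2 + x 1 ^ 2) * angVelQuot (u t) x ^ 4 ≤ E₀ := by
      have := hEt t ht; linarith
    have hBqle : Bq ≤ E₀ := by have := hEt t ht; linarith
    have m1 : MemLp (fun x => fderiv ℝ (angVortQuot (u t)) x (EuclideanSpace.single 2 1)) 2 volume :=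
      memLp_fderiv_apply_of_sobolev (contDiff_angVortQuot_of_contDiff hus)
        ((hax t ht).lintegral_sq_iteratedFDeriv_angVortQuot_lt_top hus hH) (norm_euclideanSpace_single_one_le 2)
    have m10 : MemLp (fun x => fderiv ℝ (angVortQuot (u t)) x (EuclideanSpace.single 0 1)) 2 volume :=
      memLp_fderiv_apply_of_sobolev (contDiff_angVortQuot_of_contDiff hus)
        ((hax t ht).lintegral_sq_iteratedFDeriv_angVortQuot_lt_top hus hH) (norm_euclideanSpace_single_one_le 0)
    have m11 : MemLp (fun x => fderiv ℝ (angVortQuot (u t)) x (EuclideanSpace.single 1 1)) 2 volume :=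
      memLp_fderiv_apply_of_sobolev (contDiff_angVortQuot_of_contDiff hus)
        ((hax t ht).lintegral_sq_iteratedFDeriv_angVortQuot_lt_top hus hH) (norm_euclideanSpace_single_one_le 1)
    have hale : a ≤ X t := by
      simp only [ha, hX_def]
      refine integral_mono m1.integrable_sq ((m10.integrable_sq.add m11.integrable_sq).add m1.integrable_sq)
        fun x => ?_
      simp only
      nlinarith [sq_nonneg (fderiv ℝ (angVortQuot (u t)) x (EuclideanSpace.single 0 1)),
        sq_nonneg (fderiv ℝ (angVortQuot (u t)) x (EuclideanSpace.single 1 1))]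
    have hprod : Bq * a ≤ E₀ * (-2 * dens t) :=
      mul_le_mul hBqle (hale.trans (hdX t ht)) ha0 hE00
    have hWsup_le : CA * Real.sqrt (Real.sqrt (Bq * a)) ≤ κ t / 2 := by
      simp only [hκ_def]
      have : Real.sqrt (Real.sqrt (Bq * a)) ≤ Real.sqrt (Real.sqrt (E₀ * (-2 * dens t))) :=
        Real.sqrt_le_sqrt (Real.sqrt_le_sqrt hprod)
      nlinarith [mul_le_mul_of_nonneg_left this hCA0]
    have hYt := hYnn t
    simp only [hdY_def, hY_def]
    simp only [hY_def] at hYt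
    calc 2 * ∫ x : EuclideanSpace ℝ (Fin 3), (x 0 ^ 2 + x 1 ^ 2) * angVortQuot (u t) x *
          angVortQuot (FluidPDE.timeDerivWithin (Icc 0 T) u t) x
        ≤ 2 * (CA * Real.sqrt (Real.sqrt (Bq * a))) *
            (∫ x : EuclideanSpace ℝ (Fin 3), (x 0 ^ 2 + x 1 ^ 2) * angVortQuot (u t) x ^ 2) +
          ∫ x : EuclideanSpace ℝ (Fin 3), (x 0 ^ 2 + x 1 ^ 2) * angVelQuot (u t) x ^ 4 := hsl
      _ ≤ κ t * (∫ x : EuclideanSpace ℝ (Fin 3), (x 0 ^ 2 + x 1 ^ 2) * angVortQuot (u t) x ^ 2) + E₀ := by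
          nlinarith [mul_le_mul_of_nonneg_right hWsup_le hYt]
  ------------------------------------------------------------------
  -- Step 2: the integral inequality for `Y`
  ------------------------------------------------------------------
  obtain ⟨Ymax, hYmax⟩ := (isCompact_Icc (a := (0 : ℝ)) (b := T)).exists_bound_of_continuousOn hcontY
  have hYm : ∀ s ∈ Icc 0 T, Y s ≤ Ymax := fun s hs => by
    have := hYmax s hs; rw [Real.norm_eq_abs] at this; exact (le_abs_self _).trans this
  have hYmax0 : 0 ≤ Ymax := (hYnn 0).trans (hYm 0 ⟨le_rfl, hT.le⟩)
  -- the integrable majorant of the kernel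
  set maj : ℝ → ℝ := fun s => 2 * CA * (1 + E₀ * (-2 * dens s)) with hmaj_def
  have hintD' : IntegrableOn dens (Icc 0 T) volume := (integrableOn_Icc_iff_integrableOn_Ioo (μ := volume)).2 hintD
  have imajT : IntegrableOn maj (Icc 0 T) volume := by
    have : IntegrableOn (fun s => (2 * CA) + (2 * CA * E₀ * (-2)) * dens s) (Icc 0 T) volume :=
      (integrableOn_const (C := 2 * CA) (hs := measure_Icc_lt_top.ne)).add (hintD'.const_mul _)
    exact this.congr_fun (fun s _ => by simp only [hmaj_def]; ring) measurableSet_Icc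
  have hmaj0 : ∀ s ∈ Icc 0 T, 0 ≤ maj s := fun s hs => by
    have h1 : 0 ≤ -2 * dens s := by have := hdens0 s hs; linarith
    have h2 : 0 ≤ E₀ * (-2 * dens s) := mul_nonneg hE00 h1
    exact mul_nonneg (mul_nonneg zero_le_two hCA0) (by linarith)
  have hκmaj : ∀ s ∈ Icc 0 T, κ s ≤ maj s := fun s hs => hκle s hs
  have hintY' : IntegrableOn dY (Icc 0 T) volume := (integrableOn_Icc_iff_integrableOn_Ioo (μ := volume)).2 hintY
  have hYineq : ∀ t ∈ Icc 0 T, Y t ≤ (Y 0 + E₀ * T) + (∫⁻ s in Ioo 0 t, ENNReal.ofReal (κ s * Y s)).toReal := by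
    intro t ht
    rcases eq_or_lt_of_le ht.1 with h0 | ht0
    · rw [← h0]
      simp only [Ioo_self, Measure.restrict_empty, lintegral_zero_measure, ENNReal.toReal_zero, add_zero]
      nlinarith [mul_nonneg hE00 hT.le]
    have hsubI : Ioc 0 t ⊆ Icc 0 T := Ioc_subset_Icc_self.trans (Icc_subset_Icc le_rfl ht.2)
    have hb := hbalY t ⟨ht0, ht.2⟩
    have hIoc : IntegrableOn dY (Ioc 0 t) volume := hintY'.mono_set hsubI
    -- finiteness of the two lower integrals
    have hfinK : ∫⁻ s in Ioc 0 t, ENNReal.ofReal (κ s * Y s) ≠ ⊤ := by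
      have imaj : IntegrableOn (fun s => maj s * Ymax) (Ioc 0 t) volume := (imajT.mono_set hsubI).mul_const _
      refine ne_top_of_le_ne_top (b := ∫⁻ s in Ioc 0 t, ENNReal.ofReal (maj s * Ymax)) ?_
        (setLIntegral_mono' measurableSet_Ioc fun s hs => ENNReal.ofReal_le_ofReal
          (mul_le_mul (hκmaj s (hsubI hs)) (hYm s (hsubI hs)) (hYnn s) (hmaj0 s (hsubI hs))))
      exact ((hasFiniteIntegral_iff_ofReal (ae_restrict_of_forall_mem measurableSet_Ioc fun s hs =>
        mul_nonneg (hmaj0 s (hsubI hs)) hYmax0)).1 imaj.hasFiniteIntegral).ne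
    have hvol : ∫⁻ s in Ioc 0 t, ENNReal.ofReal E₀ = ENNReal.ofReal (E₀ * t) := by
      rw [setLIntegral_const, Real.volume_Ioc, sub_zero, ← ENNReal.ofReal_mul hE00]
    have hsplit : ∫⁻ s in Ioc 0 t, ENNReal.ofReal (κ s * Y s + E₀) =
        (∫⁻ s in Ioc 0 t, ENNReal.ofReal (κ s * Y s)) + ENNReal.ofReal (E₀ * t) := by
      rw [← hvol, ← lintegral_add_right' _ aemeasurable_const]
      exact lintegral_congr fun s => ENNReal.ofReal_add (mul_nonneg (hκ0 s) (hYnn s)) hE00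
    have hfin : ∫⁻ s in Ioc 0 t, ENNReal.ofReal (κ s * Y s + E₀) ≠ ⊤ := by
      rw [hsplit]; exact ENNReal.add_ne_top.2 ⟨hfinK, ENNReal.ofReal_ne_top⟩
    have hle1 : ∫ s in Ioc 0 t, dY s ≤ (∫⁻ s in Ioc 0 t, ENNReal.ofReal (κ s * Y s + E₀)).toReal :=
      integral_le_toReal_lintegral_of_le hIoc
        (ae_restrict_of_forall_mem measurableSet_Ioc fun s _ => add_nonneg (mul_nonneg (hκ0 s) (hYnn s)) hE00)
        (ae_restrict_of_forall_mem measurableSet_Ioc fun s hs => hslice s (hsubI hs)) hfin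
    have hIoo : ∫⁻ s in Ioc 0 t, ENNReal.ofReal (κ s * Y s) = ∫⁻ s in Ioo 0 t, ENNReal.ofReal (κ s * Y s) :=
      setLIntegral_congr Ioo_ae_eq_Ioc.symm
    rw [hsplit, ENNReal.toReal_add hfinK ENNReal.ofReal_ne_top, ENNReal.toReal_ofReal (mul_nonneg hE00 ht0.le), hIoo] at hle1
    rw [intervalIntegral.integral_of_le ht0.le] at hb
    simp only [hY_def, hdY_def] at hb hle1 ⊢
    have hEt' : E₀ * t ≤ E₀ * T := mul_le_mul_of_nonneg_left ht.2 hE00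
    linarith
  ------------------------------------------------------------------
  -- Step 3: Grönwall
  ------------------------------------------------------------------
  have hc : 0 ≤ Y 0 + E₀ * T := add_nonneg (hYnn 0) (mul_nonneg hE00 hT.le)
  have hκfin : ∫⁻ s in Ioo 0 T, ENNReal.ofReal (κ s) ≠ ⊤ := by
    refine ne_top_of_le_ne_top (b := ∫⁻ s in Ioo 0 T, ENNReal.ofReal (maj s)) ?_
      (setLIntegral_mono' measurableSet_Ioo fun s hs => ENNReal.ofReal_le_ofReal (hκmaj s (Ioo_subset_Icc_self hs)))
    exact ((hasFiniteIntegral_iff_ofReal (ae_restrict_of_forall_mem measurableSet_Ioo fun s hs =>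
      hmaj0 s (Ioo_subset_Icc_self hs))).1 (imajT.mono_set Ioo_subset_Icc_self).hasFiniteIntegral).ne
  have hG := real_gronwall_Icc (a := 0) (b := T) (u := Y) (κ := κ) hc hYm (fun s _ => hκ0 s) hκfin hYineq
  -- the exponent
  have hexp : ∀ t ∈ Icc 0 T, (∫⁻ s in Ioo 0 t, ENNReal.ofReal (κ s)).toReal ≤ 2 * CA * (T + 2 * E₀ ^ 2) := by
    intro t ht
    have imaj : IntegrableOn maj (Ioo 0 T) volume := imajT.mono_set Ioo_subset_Icc_self
    have h1 : ∫⁻ s in Ioo 0 t, ENNReal.ofReal (κ s) ≤ ∫⁻ s in Ioo 0 T, ENNReal.ofReal (maj s) :=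
      (lintegral_mono_set (Ioo_subset_Ioo le_rfl ht.2)).trans
        (setLIntegral_mono' measurableSet_Ioo fun s hs => ENNReal.ofReal_le_ofReal (hκmaj s (Ioo_subset_Icc_self hs)))
    have h2 : ∫⁻ s in Ioo 0 T, ENNReal.ofReal (maj s) = ENNReal.ofReal (∫ s in Ioo 0 T, maj s) :=
      (ofReal_integral_eq_lintegral_ofReal imaj (ae_restrict_of_forall_mem measurableSet_Ioo fun s hs =>
        hmaj0 s (Ioo_subset_Icc_self hs))).symm
    have h3 : ∫ s in Ioo 0 T, maj s = 2 * CA * (T + E₀ * (-2 * (E T - E₀))) := by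
      have hbT := hbalE T ⟨hT, le_rfl⟩
      rw [intervalIntegral.integral_of_le hT.le] at hbT
      have hdint : ∫ s in Ioo 0 T, dens s = E T - E₀ := by
        rw [setIntegral_congr_set Ioo_ae_eq_Ioc]
        simp only [hE_def, hdens_def, hE₀] at hbT ⊢
        linarith
      have hd : IntegrableOn dens (Ioo 0 T) volume := hintD
      simp only [hmaj_def]
      have : (fun s => 2 * CA * (1 + E₀ * (-2 * dens s))) = fun s => (2 * CA) + (2 * CA * E₀ * (-2)) * dens s := by
        funext s; ring
      have i1 : IntegrableOn (fun _ => (2 * CA : ℝ)) (Ioo 0 T) volume :=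
        integrableOn_const (C := 2 * CA) (hs := measure_Ioo_lt_top.ne)
      have i2 : IntegrableOn (fun s => (2 * CA * E₀ * (-2)) * dens s) (Ioo 0 T) volume := hd.const_mul _
      have e1 : ∫ _ in Ioo 0 T, (2 * CA : ℝ) = 2 * CA * T := by
        rw [setIntegral_const, Measure.real, Real.volume_Ioo, sub_zero, ENNReal.toReal_ofReal hT.le, smul_eq_mul]; ring
      have e2 : ∫ s in Ioo 0 T, (2 * CA * E₀ * (-2)) * dens s = (2 * CA * E₀ * (-2)) * (E T - E₀) := by
        rw [integral_const_mul, hdint]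
      rw [this, integral_add i1 i2, e1, e2]
      ring
    have hET := hEnn T
    calc (∫⁻ s in Ioo 0 t, ENNReal.ofReal (κ s)).toReal ≤ (∫⁻ s in Ioo 0 T, ENNReal.ofReal (maj s)).toReal :=
          ENNReal.toReal_mono (by rw [h2]; exact ENNReal.ofReal_ne_top) h1
      _ = 2 * CA * (T + E₀ * (-2 * (E T - E₀))) := by
          rw [h2, ENNReal.toReal_ofReal (setIntegral_nonneg measurableSet_Ioo fun s hs =>
            hmaj0 s (Ioo_subset_Icc_self hs)), h3]
      _ ≤ 2 * CA * (T + 2 * E₀ ^ 2) := by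
          apply mul_le_mul_of_nonneg_left _ (mul_nonneg zero_le_two hCA0)
          nlinarith [mul_nonneg hE00 hET]
  intro t ht
  have h1 := hG t ht
  calc Y t ≤ (Y 0 + E₀ * T) * Real.exp ((∫⁻ s in Ioo 0 t, ENNReal.ofReal (κ s)).toReal) := h1
    _ ≤ (Y 0 + E₀ * T) * Real.exp (2 * CA * (T + 2 * E₀ ^ 2)) :=
        mul_le_mul_of_nonneg_left (Real.exp_le_exp.2 (hexp t ht)) hc

end IsTaoSolutionOn

end Literature.Analysis.FluidPDE

end
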